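import Summits.BirchSwinnertonDyer.Rank1Residual.Additive.CyclotomicSubfields
import Summits.BirchSwinnertonDyer.Rank1Residual.Additive.SemistableFieldCriterion
import HarnessLib

/-!
# X3♯/X4♯ (G-ord): Delbourgo's `d` IS the semistability defect `e_E(p)` — the minimal subfield of `ℚ(ζ_p)` over which `E` acquires good reduction

HONEST FRAMING (cell `b2b-bsdres`, run/shared/lean/b2b/bsd-rank1-residual/, verbatim in every
file): the goal of the cell is to DELETE the COMBINATION-SHAPED residual classes of the
Birch–Swinnerton-Dyer formula for ALL analytic-rank `≤ 1` elliptic curves over `ℚ` — "full BSD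
formula for every rank `≤ 1` curve in class `C`" assembled STRICTLY from published theorems — so
that the rank-`≤ 1` remainder becomes exactly the CONSTRUCTION-SHAPED classes, which are TYPED
(missing-input `Prop`s), NOT attempted. This is not "finishing BSD". Sub-cell `additive-p2`
(CLASS-OWNERS row "X3/X4 additive — pot. good ordinary / X3♯(G-ord)"), generation 5: research
route; no claim beyond the stated classes; theorems only, no definition, no new named fact;
X3♯(G-ord)/X4♯(G-ord) stay CONSTRUCTION-SHAPED.

WHAT THIS FILE DOES. Delbourgo (Compositio Math. 113 (1998)) formulates hypothesis (G) (§1.5) as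
"`E` has potential good reduction at `p` and `E` possesses good reduction over a field
`L ⊂ ℚ_p(μ_p)` where `[L : ℚ_p] = d`", with `d = #Φ_p` the order of the image of inertia (§1.3:
"`Φ_p` is one of `1, ℤ/2, ℤ/3, ℤ/4, ℤ/6`"; Lemma: (i) inertia acts through `Gal(ℚ_p(μ_p)/ℚ_p)`
⟺ (iv) `p ≡ 1 (mod d)`). The sub-cell's `TypeG W p` (gen 0, `PotGoodOrdinary.lean`) transcribes
(G) globally with SOME subfield of SOME `p`-th cyclotomic field; the census measures the defect by
additive-p4's index `e_E(p) = semistabilityIndex W p = 12/gcd(12, ord_p Δ_min)`. This file proves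
that the two `d`'s agree and that the transcription is faithful, for `p ≥ 5` and `W` globally
minimal:

* `semistabilityIndex_dvd_four_or_dvd_six`, `semistabilityIndex_mem_of_addv` — at a potentially
  good `p ≥ 5` (`ord_p j ≥ 0`): **`e_E(p) ∈ {1, 2, 3, 4, 6}`, and `∈ {2, 3, 4, 6}` at an ADDITIVE
  `p`** (the value `12`, i.e. `gcd(12, ord_p Δ_min) = 1`, would force `j ≡ 0` and `j ≡ 1728`
  `(mod p)` at once — gen 3's `j_eq_zero_or_padicValRat_j_pos_of_not_three_dvd`,
  `j_eq_or_padicValRat_j_sub_pos_of_not_two_dvd` — i.e. `p ∣ 1728 = 2⁶3³`). Delbourgo's list.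
* `hasGoodReductionAt_baseChange_iff_semistabilityIndex_dvd_finrank`,
  `forall_hasGoodReductionAt_baseChange_iff_semistabilityIndex_dvd_finrank`,
  `TypeG.forall_hasGoodReductionAt_iff_dvd_finrank` — **for every subfield `F` of a `p`-th
  cyclotomic field: `E_F` is good above `p` iff `e_E(p) ∣ [F : ℚ]`** (gen 4's local criterion
  `hasGoodReductionAt_baseChange_iff_semistabilityIndex_dvd`, "good ⟺ `e_E(p) ∣ e(w|p)`", with
  `e(w|p) = [F : ℚ]` from `CyclotomicSubfields.lean`). So Delbourgo's admissible `d` are exactly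
  the multiples of `e_E(p)` dividing `p − 1`.
* `typeG_iff_exists_intermediateField_finrank_eq_semistabilityIndex` — **`TypeG W p` iff the
  subfield of degree `e_E(p)` of (any) `ℚ(ζ_p)` exists and `E` is good over it above `p`**; with
  gen 2's `typeG_iff_not_subM_and_semistabilityIndex_dvd` ((G) ⟺ `ord_p j ≥ 0 ∧ e_E(p) ∣ p − 1`)
  this is Delbourgo's Lemma (i) ⟺ (iv) in the kernel, the field being supplied by
  `exists_intermediateField_finrank_eq_of_dvd`.
* `intermediateField_le_iff_finrank_dvd` — the subfields of `ℚ(ζ_p)` are totally ordered by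
  divisibility of degrees (`F ≤ C ↔ [F : ℚ] ∣ [C : ℚ]`); `TypeG.existsUnique_minimal_field`,
  `TypeG.forall_hasGoodReductionAt_iff_minimal_le` — **the minimal (G)-field `F₀` exists, is
  unique, has degree `d = e_E(p)`, and the (G)-fields inside `ℚ(ζ_p)` are EXACTLY the subfields
  containing `F₀`**; at an ADDITIVE `p`, `d = [F₀ : ℚ] ∈ {2, 3, 4, 6}`
  (`semistabilityIndex_mem_of_addv`): `E` is never good above `p` over `ℚ` (gen 0's no-go), is
  good over the quadratic field `ℚ(√p*) ⊆ ℚ(ζ_p)` iff `e_E(p) = 2` (the exact domain of the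
  quadratic descent of `GordDescent*.lean`), and otherwise first over the cubic / quartic / sextic
  subfield.

EFFECT. None on labels or census (HOME/b2b-bsdres-additive-p2/AUDIT-X34-GORD.md unchanged in
§§0, 2–5): bookkeeping that makes the sub-cell's objects exact — the (G)-datum of a pair is the
single integer `e_E(p) ∣ p − 1`, the (G)-field is canonical, and "TypeG (global, ∃ L ∃ F)" is
independent of the chosen cyclotomic field and equivalent to the local hypothesis as printed.

References: D. Delbourgo, Compositio Math. 113 (1998) 123–153, §1.3 (Φ_p and Lemma), §1.5 (G);
J.-P. Serre, Invent. Math. 15 (1972) §5.6; J.-P. Serre, J. Tate, Ann. of Math. 88 (1968) §2;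
A. Kraus, Manuscripta Math. 69 (1990); J. H. Silverman, *AEC* VII.5.1, VII.5.4–5.5, *ATAEC* IV §9;
L. C. Washington, *Introduction to Cyclotomic Fields*, Ch. 2.
-/

noncomputable section

open scoped Classical NumberField

open WeierstrassCurve IsDedekindDomain NumberField Literature.NumberTheory.EllipticCurves
  Literature.NumberTheory.EllipticCurves.Rank1Residual

namespace Summit.BirchSwinnertonDyer.Rank1Residual.Additive


/-! ### The subfields of `ℚ(ζ_p)` are totally ordered by divisibility of degrees -/

section Lattice

variable {L : Type} [Field L] [NumberField L] (p : ℕ) [hp : Fact p.Prime]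
  [hcyc : IsCyclotomicExtension {p} ℚ L]

/-- In a finite cyclic commutative group, `B ≤ A` as soon as `A.index ∣ B.index` (each subgroup is
the group of `index`-th powers). -/
private theorem subgroup_le_of_index_dvd {Γ : Type*} [CommGroup Γ] [IsCyclic Γ] [Finite Γ]
    {A B : Subgroup Γ} (h : A.index ∣ B.index) : B ≤ A := by
  have key : ∀ C : Subgroup Γ, C = (powMonoidHom C.index : Γ →* Γ).range := by
    intro C
    symm
    refine Subgroup.eq_of_le_of_card_ge ?_ ?_
    · rintro _ ⟨g, rfl⟩
      exact C.pow_index_mem g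
    · rw [IsCyclic.card_powMonoidHom_range, Nat.gcd_eq_right C.index_dvd_card]
      exact (Nat.div_eq_of_eq_mul_left (Nat.pos_of_ne_zero C.index_ne_zero_of_finite)
        C.card_mul_index.symm).ge
  obtain ⟨k, hk⟩ := h
  rw [key A, key B]
  rintro _ ⟨g, rfl⟩
  exact ⟨g ^ k, by simp only [powMonoidHom_apply, ← pow_mul, hk, mul_comm]⟩

include hcyc in
/-- **Subfields of a `p`-th cyclotomic field are totally ordered by divisibility of their
degrees**: `F ≤ C ↔ [F : ℚ] ∣ [C : ℚ]` (Galois correspondence with the cyclic group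
`Gal(ℚ(ζ_p)/ℚ) ≅ (ℤ/p)ˣ`, in which `B ≤ A ↔ [G : A] ∣ [G : B]`; Mathlib
`IntermediateField.finrank_eq_fixingSubgroup_index`). Washington, *Introduction to Cyclotomic
Fields*, Ch. 2. -/
theorem intermediateField_le_iff_finrank_dvd (F C : IntermediateField ℚ L) :
    F ≤ C ↔ Module.finrank ℚ F ∣ Module.finrank ℚ C := by
  classical
  haveI : IsGalois ℚ L := IsCyclotomicExtension.isGalois {p} ℚ L
  rw [IntermediateField.finrank_eq_fixingSubgroup_index,
    IntermediateField.finrank_eq_fixingSubgroup_index]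
  constructor
  · intro h
    exact Subgroup.index_dvd_of_le ((IntermediateField.le_iff_le _ _).mp
      (by rwa [IsGalois.fixedField_fixingSubgroup]))
  · intro h
    let e : Gal(L/ℚ) ≃* (ZMod p)ˣ := IsCyclotomicExtension.Rat.galEquivZMod p L
    have h' : (F.fixingSubgroup.map (e : Gal(L/ℚ) →* (ZMod p)ˣ)).index ∣
        (C.fixingSubgroup.map (e : Gal(L/ℚ) →* (ZMod p)ˣ)).index := by
      rwa [Subgroup.index_map_equiv, Subgroup.index_map_equiv]
    have hle := subgroup_le_of_index_dvd h'
    have hinj : Function.Injective ((e : Gal(L/ℚ) →* (ZMod p)ˣ)) := fun a b hab => e.injective hab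
    have hsub : C.fixingSubgroup ≤ F.fixingSubgroup := by
      rw [← Subgroup.comap_map_eq_self_of_injective hinj F.fixingSubgroup,
        ← Subgroup.comap_map_eq_self_of_injective hinj C.fixingSubgroup]
      exact Subgroup.comap_mono hle
    have := (IntermediateField.le_iff_le C.fixingSubgroup F).mpr hsub
    rwa [IsGalois.fixedField_fixingSubgroup] at this

end Lattice

/-! ### The semistability defect at a potentially good `p ≥ 5` is `2, 3, 4` or `6` (never `12`) -/

section Defect

variable (W : WeierstrassCurve ℚ) [W.IsElliptic] [W.IsGloballyMinimal] (p : ℕ) [hp : Fact p.Prime]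

/-- `ord_p 1728 = 0` for `p ≥ 5` (`1728 = 2⁶·3³`). -/
private theorem padicValRat_1728_eq_zero (hp5 : 5 ≤ p) : padicValRat p (1728 : ℚ) = 0 := by
  have h : ¬ p ∣ 1728 := by
    intro hd
    have h' : p ∣ 2 ^ 6 * 3 ^ 3 := by norm_num; exact hd
    rcases (Nat.Prime.dvd_mul hp.out).mp h' with h2 | h3
    · have := Nat.le_of_dvd (by norm_num) (Nat.Prime.dvd_of_dvd_pow hp.out h2); omega
    · have := Nat.le_of_dvd (by norm_num) (Nat.Prime.dvd_of_dvd_pow hp.out h3); omega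
  have : padicValRat p ((1728 : ℕ) : ℚ) = 0 := by
    rw [padicValRat.of_nat, Nat.cast_eq_zero, padicValNat.eq_zero_of_not_dvd h]
  exact_mod_cast this

/-- **At a potentially good `p ≥ 5` the semistability defect is `1, 2, 3, 4` or `6`**
(`e_E(p) ∣ 4 ∨ e_E(p) ∣ 6`; the value `12 = 12/gcd(12, ord_p Δ_min)` of the census index, i.e.
`gcd(12, ord_p Δ_min) = 1`, does not occur when `ord_p j ≥ 0`): if neither `2` nor `3` divides
`ord_p Δ_min` then `j ≡ 0` AND `j ≡ 1728 (mod p)` (gen 3's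
`j_eq_zero_or_padicValRat_j_pos_of_not_three_dvd`, `j_eq_or_padicValRat_j_sub_pos_of_not_two_dvd`),
whence `p ∣ 1728 = 2⁶3³`. This is the list `d ∈ {1, 2, 3, 4, 6}` of Delbourgo, Compositio Math.
113 (1998) §1.3 ("Φ_p is one of 1, ℤ/2ℤ, ℤ/3ℤ, ℤ/4ℤ, ℤ/6ℤ", p. 127); Serre, *Propriétés galoisiennes* §5.6 (`Φ_p` cyclic of order
`12/gcd(12, v(Δ))`). -/
theorem semistabilityIndex_dvd_four_or_dvd_six (hp5 : 5 ≤ p) (hj : 0 ≤ padicValRat p W.j) :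
    semistabilityIndex W p ∣ 4 ∨ semistabilityIndex W p ∣ 6 := by
  by_cases h3 : 3 ∣ padicValInt p W.minimalDiscriminantInt
  · exact Or.inl (semistabilityIndex_dvd_four_of_three_dvd W p h3)
  by_cases h2 : 2 ∣ padicValInt p W.minimalDiscriminantInt
  · exact Or.inr (semistabilityIndex_dvd_six_of_two_dvd W p h2)
  exfalso
  have h1728 := padicValRat_1728_eq_zero p hp5
  have hA := j_eq_zero_or_padicValRat_j_pos_of_not_three_dvd W p hj h3
  have hB := j_eq_or_padicValRat_j_sub_pos_of_not_two_dvd W p hp5 hj h2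
  rcases hA with hj0 | hjpos
  · rcases hB with hj1728 | hsub
    · rw [hj0] at hj1728; norm_num at hj1728
    · rw [hj0, zero_sub, padicValRat.neg, h1728] at hsub
      exact lt_irrefl _ hsub
  · rcases hB with hj1728 | hsub
    · rw [hj1728, h1728] at hjpos
      exact lt_irrefl _ hjpos
    · have hj0 : W.j ≠ 0 := by
        rintro h; rw [h, padicValRat.zero] at hjpos; exact lt_irrefl _ hjpos
      have hs0 : W.j - 1728 ≠ 0 := by
        rintro h; rw [h, padicValRat.zero] at hsub; exact lt_irrefl _ hsub
      have hsum : W.j + -(W.j - 1728) = 1728 := by ring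
      have hne : W.j + -(W.j - 1728) ≠ 0 := by rw [hsum]; norm_num
      have hmin := padicValRat.min_le_padicValRat_add (p := p) hne
      rw [hsum, h1728, padicValRat.neg] at hmin
      have : 0 < min (padicValRat p W.j) (padicValRat p (W.j - 1728)) := lt_min hjpos hsub
      linarith

/-- **At an ADDITIVE potentially good `p ≥ 5` the semistability defect is `2, 3, 4` or `6`**
(`semistabilityIndex_ne_one_of_addv` excludes `1`). -/
theorem semistabilityIndex_mem_of_addv (hp5 : 5 ≤ p) (hadd : Addv W p)
    (hj : 0 ≤ padicValRat p W.j) :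
    semistabilityIndex W p = 2 ∨ semistabilityIndex W p = 3 ∨ semistabilityIndex W p = 4 ∨
      semistabilityIndex W p = 6 := by
  have hne1 := semistabilityIndex_ne_one_of_addv W p hp5 hadd hj
  rcases semistabilityIndex_dvd_four_or_dvd_six W p hp5 hj with h | h
  · have hle := Nat.le_of_dvd (by norm_num) h
    interval_cases hse : semistabilityIndex W p <;> simp_all
  · have hle := Nat.le_of_dvd (by norm_num) h
    interval_cases hse : semistabilityIndex W p <;> simp_all

end Defect

/-! ### Delbourgo's `d`: over a subfield `F ⊆ ℚ(ζ_p)`, `E_F` is good above `p` iff `e_E(p) ∣ [F : ℚ]` -/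

section Curve

variable (W : WeierstrassCurve ℚ) [W.IsElliptic] [W.IsGloballyMinimal] (p : ℕ) [hp : Fact p.Prime]
  {L : Type} [Field L] [NumberField L] [hcyc : IsCyclotomicExtension {p} ℚ L]
  (F : IntermediateField ℚ L)

include hcyc in
/-- **Over a subfield `F` of `ℚ(ζ_p)`, `E_F` is good at the prime `w ∣ p` iff `e_E(p) ∣ [F : ℚ]`**
(`p ≥ 5`, `ord_p j(E) ≥ 0`, `W` globally minimal): gen 4's local criterion
`hasGoodReductionAt_baseChange_iff_semistabilityIndex_dvd` (`good ⟺ e_E(p) ∣ e(w|p)`) with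
`e(w|p) = [F : ℚ]` (`ramificationIdx_eq_finrank_of_intermediateField_cyclotomic`). This is the
precise content of Delbourgo's hypothesis (G) "E possesses good reduction over a field
`L ⊂ ℚ_p(μ_p)` where `[L : ℚ_p] = d`" (Compositio Math. 113 (1998) §1.5): the admissible `d` are
exactly the multiples of `e_E(p)` dividing `p − 1`. -/
theorem hasGoodReductionAt_baseChange_iff_semistabilityIndex_dvd_finrank (hp5 : 5 ≤ p)
    (hj : 0 ≤ padicValRat p W.j) (w : HeightOneSpectrum (𝓞 F)) (hw : (p : 𝓞 F) ∈ w.asIdeal) :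
    (W.baseChange F).HasGoodReductionAt w ↔ semistabilityIndex W p ∣ Module.finrank ℚ F := by
  haveI : NumberField F := NumberField.of_module_finite ℚ F
  haveI := liesOver_span_of_natCast_mem p F w hw
  rw [hasGoodReductionAt_baseChange_iff_semistabilityIndex_dvd W p F w hp5 hj hw,
    ramificationIdx_eq_finrank_of_intermediateField_cyclotomic p F w]

include hcyc in
/-- The same for "every prime of `F` above `p`" (there is exactly one,
`heightOneSpectrum_eq_of_intermediateField_cyclotomic`, and at least one,
`exists_heightOneSpectrum_natCast_mem`): **`E_F` is good above `p` iff `e_E(p) ∣ [F : ℚ]`**. -/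
theorem forall_hasGoodReductionAt_baseChange_iff_semistabilityIndex_dvd_finrank (hp5 : 5 ≤ p)
    (hj : 0 ≤ padicValRat p W.j) :
    (∀ w : HeightOneSpectrum (𝓞 F), (p : 𝓞 F) ∈ w.asIdeal →
        (W.baseChange F).HasGoodReductionAt w) ↔
      semistabilityIndex W p ∣ Module.finrank ℚ F := by
  haveI : NumberField F := NumberField.of_module_finite ℚ F
  obtain ⟨w₀, hw₀⟩ := exists_heightOneSpectrum_natCast_mem F p
  exact ⟨fun h => (hasGoodReductionAt_baseChange_iff_semistabilityIndex_dvd_finrank W p F hp5 hj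
      w₀ hw₀).mp (h w₀ hw₀),
    fun h w hw => (hasGoodReductionAt_baseChange_iff_semistabilityIndex_dvd_finrank W p F hp5 hj
      w hw).mpr h⟩

end Curve

/-! ### The minimal (G)-field -/

section Minimal

variable (W : WeierstrassCurve ℚ) [W.IsElliptic] [W.IsGloballyMinimal] (p : ℕ) [hp : Fact p.Prime]
  (L : Type) [Field L] [NumberField L] [hcyc : IsCyclotomicExtension {p} ℚ L]

/-- **Delbourgo's `d` is the semistability defect.** For `p ≥ 5`, a globally minimal `W` and ANY
`p`-th cyclotomic field `L`: `(E, p)` is of type (G) iff the (unique) subfield `F ⊆ L` of degree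
`e_E(p) = semistabilityIndex W p` exists and `E_F` has good reduction above `p`. (⇒): type (G)
gives `ord_p j ≥ 0` and `e_E(p) ∣ p − 1` (gen 2's `typeG_iff_not_subM_and_semistabilityIndex_dvd`),
so the subfield of degree `e_E(p)` exists (`exists_intermediateField_finrank_eq_of_dvd`) and is a
(G)-field by `forall_hasGoodReductionAt_baseChange_iff_semistabilityIndex_dvd_finrank`; (⇐) is the
definition of `TypeG`. With `semistabilityIndex_le_finrank_of_forall_hasGoodReductionAt` and
`intermediateField_eq_of_finrank_eq` this field is the LEAST (G)-field in `L` and is unique. -/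
theorem typeG_iff_exists_intermediateField_finrank_eq_semistabilityIndex (hp5 : 5 ≤ p) :
    TypeG W p ↔ ∃ F : IntermediateField ℚ L, Module.finrank ℚ F = semistabilityIndex W p ∧
      ∀ w : HeightOneSpectrum (𝓞 F), (p : 𝓞 F) ∈ w.asIdeal →
        (W.baseChange F).HasGoodReductionAt w := by
  constructor
  · intro hG
    have hj := padicValRat_j_nonneg_of_typeG W p hG
    have hdvd : semistabilityIndex W p ∣ p - 1 :=
      ((typeG_iff_not_subM_and_semistabilityIndex_dvd W p hp5).mp hG).2
    obtain ⟨F, -, hF⟩ := exists_intermediateField_finrank_eq_of_dvd p L hdvd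
    exact ⟨F, hF, (forall_hasGoodReductionAt_baseChange_iff_semistabilityIndex_dvd_finrank W p F
      hp5 hj).mpr (by rw [hF])⟩
  · rintro ⟨F, -, hF⟩
    exact ⟨L, inferInstance, inferInstance, inferInstance, F, hF⟩

/-- **The (G)-fields inside `ℚ(ζ_p)` are exactly the subfields of degree divisible by `e_E(p)`**
(`p ≥ 5`, `(E, p)` of type (G), `W` globally minimal): for every subfield `F` of a `p`-th
cyclotomic field, `E_F` is good above `p` iff `e_E(p) ∣ [F : ℚ]`. -/
theorem TypeG.forall_hasGoodReductionAt_iff_dvd_finrank (hp5 : 5 ≤ p) (hG : TypeG W p)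
    (F : IntermediateField ℚ L) :
    (∀ w : HeightOneSpectrum (𝓞 F), (p : 𝓞 F) ∈ w.asIdeal →
        (W.baseChange F).HasGoodReductionAt w) ↔
      semistabilityIndex W p ∣ Module.finrank ℚ F :=
  forall_hasGoodReductionAt_baseChange_iff_semistabilityIndex_dvd_finrank W p F hp5
    (padicValRat_j_nonneg_of_typeG W p hG)

/-- **Existence and uniqueness of the minimal (G)-field** (`p ≥ 5`, `(E, p)` of type (G), `W`
globally minimal, `L` any `p`-th cyclotomic field): there is exactly one subfield `F ⊆ L` of
degree `e_E(p)`; `E_F` is good above `p`; and every subfield `F' ⊆ L` over which `E` is good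
above `p` has `e_E(p) ∣ [F' : ℚ]`, in particular `[F' : ℚ] ≥ [F : ℚ]`. -/
theorem TypeG.existsUnique_minimal_field (hp5 : 5 ≤ p) (hG : TypeG W p) :
    ∃! F : IntermediateField ℚ L, Module.finrank ℚ F = semistabilityIndex W p ∧
      (∀ w : HeightOneSpectrum (𝓞 F), (p : 𝓞 F) ∈ w.asIdeal →
        (W.baseChange F).HasGoodReductionAt w) ∧
      ∀ F' : IntermediateField ℚ L, (∀ w : HeightOneSpectrum (𝓞 F'), (p : 𝓞 F') ∈ w.asIdeal →
        (W.baseChange F').HasGoodReductionAt w) → Module.finrank ℚ F ≤ Module.finrank ℚ F' := by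
  obtain ⟨F, hFd, hFgood⟩ :=
    (typeG_iff_exists_intermediateField_finrank_eq_semistabilityIndex W p L hp5).mp hG
  refine ⟨F, ⟨hFd, hFgood, fun F' hF' => ?_⟩, fun F' hF' => ?_⟩
  · rw [hFd]
    exact semistabilityIndex_le_finrank_of_forall_hasGoodReductionAt W p F' hF'
  · exact intermediateField_eq_of_finrank_eq p F' F (hF'.1.trans hFd.symm)

/-- **The (G)-fields inside `ℚ(ζ_p)` are exactly the subfields containing the minimal one**
(`p ≥ 5`, `(E, p)` of type (G), `W` globally minimal): if `F₀ ⊆ L` is the subfield of degree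
`e_E(p)`, then for every subfield `F ⊆ L`, `E_F` is good above `p` iff `F₀ ≤ F`
(`TypeG.forall_hasGoodReductionAt_iff_dvd_finrank` + `intermediateField_le_iff_finrank_dvd`). -/
theorem TypeG.forall_hasGoodReductionAt_iff_minimal_le (hp5 : 5 ≤ p) (hG : TypeG W p)
    (F₀ : IntermediateField ℚ L) (hF₀ : Module.finrank ℚ F₀ = semistabilityIndex W p)
    (F : IntermediateField ℚ L) :
    (∀ w : HeightOneSpectrum (𝓞 F), (p : 𝓞 F) ∈ w.asIdeal →
        (W.baseChange F).HasGoodReductionAt w) ↔ F₀ ≤ F := by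
  rw [TypeG.forall_hasGoodReductionAt_iff_dvd_finrank W p L hp5 hG F,
    intermediateField_le_iff_finrank_dvd p F₀ F, hF₀]

end Minimal

end Summit.BirchSwinnertonDyer.Rank1Residual.Additive

end
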